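import Summits.BirchSwinnertonDyer.Rank1Residual.P2.CongruentNumberPairsAtTwo
import HarnessLib

/-!
# Sub-lane «bsd-p2»: PAIRS `(E_n, 2)` CLOSED IN THE KERNEL — instances, even `n ∈ U_CN` with
# `s(n) = 0` (12 pairs; journal door of `P2/CongruentNumberPairsAtTwo.lean`)

HONEST FRAMING (sub-lane «bsd-p2», run/shared/lean/b2b/bsd-rank1-residual/p2/, verbatim in every
file): the target of record is the FULL Birch–Swinnerton-Dyer formula for EVERY analytic-rank `≤ 1`
`E/ℚ` at ALL primes INCLUDING `2`; the odd-prime class ledger is referee A's; the `2`-part is OPEN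
(cells O1 = X5 ∖ CM and O12 = the CM corner) and under census by «bsd-p2». Census / instrument
output at `2` = EVIDENCE / conjecture items with held-out validation, NEVER a Literature fact;
certificates close PAIRS (one isogeny class, `p = 2`), never classes. This file asserts NO
arithmetic fact. For each even square-free `n` of the in-range congruent-number universe `U_CN`
(conductor `32n²`/`16n² < 5·10⁵`; p2-monsky-eng's `p2/monsky/eng/dry/step0-bypro/U_CN.tsv`) with
Monsky Selmer rank `s(n) = 0` (ibid. `U_CN.minor-certs.tsv` @1193270bf93bd68b, column `det_M = 1`;
12 rows of this parity), the kernel re-derives Monsky's matrix ENTRY BY ENTRY (`norm_num` on the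
Jacobi symbols; the rows agree with monsky-eng's `matrix_rows(bits)` column, an independent
implementation), checks `det M = 1` by `decide`, and concludes `BSD(E_n, 2)` through the JOURNAL door
`bsdp_two_congruentNumberCurve_of_det_even` — modulo the named facts Monsky 1994, Burungale–Tian
2026 Thm 1.1, Deuring–Hecke, Burungale–Flach 2024 Cor 2, all as binders; the [PRE] door (Smith 2016
Cor 1.3, `…_of_det_even_smith`) closes the same pairs from the same determinant lemmas. Cells:
`coveredC8` (§3 of the door file) — pairs, not classes; the census word is the lead's (U-25). Nothing
booked; no mark moved. Unit `b2b-bsdres-p2-typer` GEN 3 (p2-lead T-25 / ME-6); NEW file. References: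
[HeathBrown1994SelmerCongruentII] Appendix (Monsky); [BurungaleTian2026] Thm 1.1; [BurungaleFlach2024]
Cor 2; [Miller2011LMS] Def 1.1; HOME/p2/monsky/eng/dry/step0-bypro/U_CN.minor-certs.tsv.
-/

noncomputable section

open scoped Classical

open Matrix WeierstrassCurve Literature.NumberTheory.EllipticCurves
  Literature.NumberTheory.EllipticCurves.HeathBrown1994

set_option autoImplicit false

namespace Summit.BirchSwinnertonDyer.Rank1Residual.P2

/-- `n = 2`: `n ≡ 2 (mod 8)`, Cremona class of `E_{2}` = `64a1` (`N = 64`); Monsky's matrix (even case, `k = 0`) has rows `(empty)` and `det M = 1`, i.e. `s(2) = 0`. [cite: HeathBrown1994SelmerCongruentII, Appendix (Monsky), typescript p. 41 L20–L36] -/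
theorem det_monskyMatrixEven_2 : (monskyMatrixEven (![] : Fin 0 → ℕ)).det = 1 := by decide

/-- **`BSD(E_{2}, 2)`** (`y² = x³ − 2²x`, class `64a1`), journal door: Monsky (`hM`) + Burungale–Tian (`hBT`) + Deuring–Hecke (`hH`) + Burungale–Flach (`hBF`); membership `s(2) = 0` by `det_monskyMatrixEven_2`. [cite: BurungaleTian2026, Thm. 1.1] [cite: BurungaleFlach2024, Cor. 2] [cite: Miller2011LMS, Def. 1.1] -/
theorem bsdp_two_congruentNumberCurve_2 (hM : monsky_card_selmerGroup_two_even)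
    (hBT : burungaleTian_analyticRank_eq_zero_of_selmerCorank_eq_zero_of_hasCM)
    (hH : hasEntireLFunction_of_j_mem_maximalCMJInvariants)
    (hBF : bsdTriple_of_hasCM_of_L_one_ne_zero) : BSDp (congruentNumberCurve 2) 2 :=
  bsdp_two_congruentNumberCurve_of_det_even (![] : Fin 0 → ℕ) hM hBT hH hBF (fun i => i.elim0) (fun i => i.elim0)
    (Function.injective_of_subsingleton _) det_monskyMatrixEven_2 (by simp)

/-- `n = 10` = 2 · 5: `n ≡ 2 (mod 8)`, Cremona class of `E_{10}` = `1600o2` (`N = 1600`); Monsky's matrix (even case, `k = 1`) has rows `10;11` and `det M = 1`, i.e. `s(10) = 0`. [cite: HeathBrown1994SelmerCongruentII, Appendix (Monsky), typescript p. 41 L20–L36] -/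
theorem det_monskyMatrixEven_10 : (monskyMatrixEven ![5]).det = 1 := by
  have e : monskyMatrixEven ![5] =
      Matrix.fromBlocks !![1] !![0] !![1] !![1] := by
    ext i j
    fin_cases i <;> fin_cases j <;>
      norm_num [monskyMatrixEven, legendreMatrix, legendreDiagonal, addLegendreSym,
        Matrix.fromBlocks, Finset.sum_erase_eq_sub, Fin.sum_univ_succ, Matrix.cons_val_succ,
        Matrix.cons_val_zero, CharTwo.two_eq_zero, three_eq_one_zmod_two]
  rw [e]; decide

/-- **`BSD(E_{10}, 2)`** (`y² = x³ − 10²x`, class `1600o2`), journal door: Monsky (`hM`) + Burungale–Tian (`hBT`) + Deuring–Hecke (`hH`) + Burungale–Flach (`hBF`); membership `s(10) = 0` by `det_monskyMatrixEven_10`. [cite: BurungaleTian2026, Thm. 1.1] [cite: BurungaleFlach2024, Cor. 2] [cite: Miller2011LMS, Def. 1.1] -/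
theorem bsdp_two_congruentNumberCurve_10 (hM : monsky_card_selmerGroup_two_even)
    (hBT : burungaleTian_analyticRank_eq_zero_of_selmerCorank_eq_zero_of_hasCM)
    (hH : hasEntireLFunction_of_j_mem_maximalCMJInvariants)
    (hBF : bsdTriple_of_hasCM_of_L_one_ne_zero) : BSDp (congruentNumberCurve 10) 2 :=
  bsdp_two_congruentNumberCurve_of_det_even ![5] hM hBT hH hBF
    (by intro i; fin_cases i; norm_num) (by intro i; fin_cases i; decide) (by decide)
    det_monskyMatrixEven_10 (by simp)

/-- `n = 26` = 2 · 13: `n ≡ 2 (mod 8)`, Cremona class of `E_{26}` = `10816bb2` (`N = 10816`); Monsky's matrix (even case, `k = 1`) has rows `10;11` and `det M = 1`, i.e. `s(26) = 0`. [cite: HeathBrown1994SelmerCongruentII, Appendix (Monsky), typescript p. 41 L20–L36] -/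
theorem det_monskyMatrixEven_26 : (monskyMatrixEven ![13]).det = 1 := by
  have e : monskyMatrixEven ![13] =
      Matrix.fromBlocks !![1] !![0] !![1] !![1] := by
    ext i j
    fin_cases i <;> fin_cases j <;>
      norm_num [monskyMatrixEven, legendreMatrix, legendreDiagonal, addLegendreSym,
        Matrix.fromBlocks, Finset.sum_erase_eq_sub, Fin.sum_univ_succ, Matrix.cons_val_succ,
        Matrix.cons_val_zero, CharTwo.two_eq_zero, three_eq_one_zmod_two]
  rw [e]; decide

/-- **`BSD(E_{26}, 2)`** (`y² = x³ − 26²x`, class `10816bb2`), journal door: Monsky (`hM`) + Burungale–Tian (`hBT`) + Deuring–Hecke (`hH`) + Burungale–Flach (`hBF`); membership `s(26) = 0` by `det_monskyMatrixEven_26`. [cite: BurungaleTian2026, Thm. 1.1] [cite: BurungaleFlach2024, Cor. 2] [cite: Miller2011LMS, Def. 1.1] -/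
theorem bsdp_two_congruentNumberCurve_26 (hM : monsky_card_selmerGroup_two_even)
    (hBT : burungaleTian_analyticRank_eq_zero_of_selmerCorank_eq_zero_of_hasCM)
    (hH : hasEntireLFunction_of_j_mem_maximalCMJInvariants)
    (hBF : bsdTriple_of_hasCM_of_L_one_ne_zero) : BSDp (congruentNumberCurve 26) 2 :=
  bsdp_two_congruentNumberCurve_of_det_even ![13] hM hBT hH hBF
    (by intro i; fin_cases i; norm_num) (by intro i; fin_cases i; decide) (by decide)
    det_monskyMatrixEven_26 (by simp)

/-- `n = 42` = 2 · 3 · 7: `n ≡ 2 (mod 8)`, Cremona class of `E_{42}` = `28224fp2` (`N = 28224`); Monsky's matrix (even case, `k = 2`) has rows `1110;0101;1010;0011` and `det M = 1`, i.e. `s(42) = 0`. [cite: HeathBrown1994SelmerCongruentII, Appendix (Monsky), typescript p. 41 L20–L36] -/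
theorem det_monskyMatrixEven_42 : (monskyMatrixEven ![3, 7]).det = 1 := by
  have e : monskyMatrixEven ![3, 7] =
      Matrix.fromBlocks !![1, 1; 0, 1] !![1, 0; 0, 1] !![1, 0; 0, 0] !![1, 0; 1, 1] := by
    ext i j
    fin_cases i <;> fin_cases j <;>
      norm_num [monskyMatrixEven, legendreMatrix, legendreDiagonal, addLegendreSym,
        Matrix.fromBlocks, Finset.sum_erase_eq_sub, Fin.sum_univ_succ, Matrix.cons_val_succ,
        Matrix.cons_val_zero, CharTwo.two_eq_zero, three_eq_one_zmod_two]
  rw [e]; decide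

/-- **`BSD(E_{42}, 2)`** (`y² = x³ − 42²x`, class `28224fp2`), journal door: Monsky (`hM`) + Burungale–Tian (`hBT`) + Deuring–Hecke (`hH`) + Burungale–Flach (`hBF`); membership `s(42) = 0` by `det_monskyMatrixEven_42`. [cite: BurungaleTian2026, Thm. 1.1] [cite: BurungaleFlach2024, Cor. 2] [cite: Miller2011LMS, Def. 1.1] -/
theorem bsdp_two_congruentNumberCurve_42 (hM : monsky_card_selmerGroup_two_even)
    (hBT : burungaleTian_analyticRank_eq_zero_of_selmerCorank_eq_zero_of_hasCM)
    (hH : hasEntireLFunction_of_j_mem_maximalCMJInvariants)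
    (hBF : bsdTriple_of_hasCM_of_L_one_ne_zero) : BSDp (congruentNumberCurve 42) 2 :=
  bsdp_two_congruentNumberCurve_of_det_even ![3, 7] hM hBT hH hBF
    (by intro i; fin_cases i <;> norm_num) (by intro i; fin_cases i <;> decide) (by decide)
    det_monskyMatrixEven_42 (by simp [Fin.prod_univ_succ])

/-- `n = 58` = 2 · 29: `n ≡ 2 (mod 8)`, Cremona class of `E_{58}` = `53824r2` (`N = 53824`); Monsky's matrix (even case, `k = 1`) has rows `10;11` and `det M = 1`, i.e. `s(58) = 0`. [cite: HeathBrown1994SelmerCongruentII, Appendix (Monsky), typescript p. 41 L20–L36] -/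
theorem det_monskyMatrixEven_58 : (monskyMatrixEven ![29]).det = 1 := by
  have e : monskyMatrixEven ![29] =
      Matrix.fromBlocks !![1] !![0] !![1] !![1] := by
    ext i j
    fin_cases i <;> fin_cases j <;>
      norm_num [monskyMatrixEven, legendreMatrix, legendreDiagonal, addLegendreSym,
        Matrix.fromBlocks, Finset.sum_erase_eq_sub, Fin.sum_univ_succ, Matrix.cons_val_succ,
        Matrix.cons_val_zero, CharTwo.two_eq_zero, three_eq_one_zmod_two]
  rw [e]; decide

/-- **`BSD(E_{58}, 2)`** (`y² = x³ − 58²x`, class `53824r2`), journal door: Monsky (`hM`) + Burungale–Tian (`hBT`) + Deuring–Hecke (`hH`) + Burungale–Flach (`hBF`); membership `s(58) = 0` by `det_monskyMatrixEven_58`. [cite: BurungaleTian2026, Thm. 1.1] [cite: BurungaleFlach2024, Cor. 2] [cite: Miller2011LMS, Def. 1.1] -/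
theorem bsdp_two_congruentNumberCurve_58 (hM : monsky_card_selmerGroup_two_even)
    (hBT : burungaleTian_analyticRank_eq_zero_of_selmerCorank_eq_zero_of_hasCM)
    (hH : hasEntireLFunction_of_j_mem_maximalCMJInvariants)
    (hBF : bsdTriple_of_hasCM_of_L_one_ne_zero) : BSDp (congruentNumberCurve 58) 2 :=
  bsdp_two_congruentNumberCurve_of_det_even ![29] hM hBT hH hBF
    (by intro i; fin_cases i; norm_num) (by intro i; fin_cases i; decide) (by decide)
    det_monskyMatrixEven_58 (by simp)

/-- `n = 66` = 2 · 3 · 11: `n ≡ 2 (mod 8)`, Cremona class of `E_{66}` = `69696gm2` (`N = 69696`); Monsky's matrix (even case, `k = 2`) has rows `0010;1101;1001;0101` and `det M = 1`, i.e. `s(66) = 0`. [cite: HeathBrown1994SelmerCongruentII, Appendix (Monsky), typescript p. 41 L20–L36] -/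
theorem det_monskyMatrixEven_66 : (monskyMatrixEven ![3, 11]).det = 1 := by
  have e : monskyMatrixEven ![3, 11] =
      Matrix.fromBlocks !![0, 0; 1, 1] !![1, 0; 0, 1] !![1, 0; 0, 1] !![0, 1; 0, 1] := by
    ext i j
    fin_cases i <;> fin_cases j <;>
      norm_num [monskyMatrixEven, legendreMatrix, legendreDiagonal, addLegendreSym,
        Matrix.fromBlocks, Finset.sum_erase_eq_sub, Fin.sum_univ_succ, Matrix.cons_val_succ,
        Matrix.cons_val_zero, CharTwo.two_eq_zero, three_eq_one_zmod_two] <;> decide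
  rw [e]; decide

/-- **`BSD(E_{66}, 2)`** (`y² = x³ − 66²x`, class `69696gm2`), journal door: Monsky (`hM`) + Burungale–Tian (`hBT`) + Deuring–Hecke (`hH`) + Burungale–Flach (`hBF`); membership `s(66) = 0` by `det_monskyMatrixEven_66`. [cite: BurungaleTian2026, Thm. 1.1] [cite: BurungaleFlach2024, Cor. 2] [cite: Miller2011LMS, Def. 1.1] -/
theorem bsdp_two_congruentNumberCurve_66 (hM : monsky_card_selmerGroup_two_even)
    (hBT : burungaleTian_analyticRank_eq_zero_of_selmerCorank_eq_zero_of_hasCM)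
    (hH : hasEntireLFunction_of_j_mem_maximalCMJInvariants)
    (hBF : bsdTriple_of_hasCM_of_L_one_ne_zero) : BSDp (congruentNumberCurve 66) 2 :=
  bsdp_two_congruentNumberCurve_of_det_even ![3, 11] hM hBT hH hBF
    (by intro i; fin_cases i <;> norm_num) (by intro i; fin_cases i <;> decide) (by decide)
    det_monskyMatrixEven_66 (by simp [Fin.prod_univ_succ])

/-- `n = 74` = 2 · 37: `n ≡ 2 (mod 8)`, Cremona class of `E_{74}` = `87616z2` (`N = 87616`); Monsky's matrix (even case, `k = 1`) has rows `10;11` and `det M = 1`, i.e. `s(74) = 0`. [cite: HeathBrown1994SelmerCongruentII, Appendix (Monsky), typescript p. 41 L20–L36] -/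
theorem det_monskyMatrixEven_74 : (monskyMatrixEven ![37]).det = 1 := by
  have e : monskyMatrixEven ![37] =
      Matrix.fromBlocks !![1] !![0] !![1] !![1] := by
    ext i j
    fin_cases i <;> fin_cases j <;>
      norm_num [monskyMatrixEven, legendreMatrix, legendreDiagonal, addLegendreSym,
        Matrix.fromBlocks, Finset.sum_erase_eq_sub, Fin.sum_univ_succ, Matrix.cons_val_succ,
        Matrix.cons_val_zero, CharTwo.two_eq_zero, three_eq_one_zmod_two]
  rw [e]; decide

/-- **`BSD(E_{74}, 2)`** (`y² = x³ − 74²x`, class `87616z2`), journal door: Monsky (`hM`) + Burungale–Tian (`hBT`) + Deuring–Hecke (`hH`) + Burungale–Flach (`hBF`); membership `s(74) = 0` by `det_monskyMatrixEven_74`. [cite: BurungaleTian2026, Thm. 1.1] [cite: BurungaleFlach2024, Cor. 2] [cite: Miller2011LMS, Def. 1.1] -/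
theorem bsdp_two_congruentNumberCurve_74 (hM : monsky_card_selmerGroup_two_even)
    (hBT : burungaleTian_analyticRank_eq_zero_of_selmerCorank_eq_zero_of_hasCM)
    (hH : hasEntireLFunction_of_j_mem_maximalCMJInvariants)
    (hBF : bsdTriple_of_hasCM_of_L_one_ne_zero) : BSDp (congruentNumberCurve 74) 2 :=
  bsdp_two_congruentNumberCurve_of_det_even ![37] hM hBT hH hBF
    (by intro i; fin_cases i; norm_num) (by intro i; fin_cases i; decide) (by decide)
    det_monskyMatrixEven_74 (by simp)

/-- `n = 106` = 2 · 53: `n ≡ 2 (mod 8)`, Cremona class of `E_{106}` = `179776i2` (`N = 179776`); Monsky's matrix (even case, `k = 1`) has rows `10;11` and `det M = 1`, i.e. `s(106) = 0`. [cite: HeathBrown1994SelmerCongruentII, Appendix (Monsky), typescript p. 41 L20–L36] -/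
theorem det_monskyMatrixEven_106 : (monskyMatrixEven ![53]).det = 1 := by
  have e : monskyMatrixEven ![53] =
      Matrix.fromBlocks !![1] !![0] !![1] !![1] := by
    ext i j
    fin_cases i <;> fin_cases j <;>
      norm_num [monskyMatrixEven, legendreMatrix, legendreDiagonal, addLegendreSym,
        Matrix.fromBlocks, Finset.sum_erase_eq_sub, Fin.sum_univ_succ, Matrix.cons_val_succ,
        Matrix.cons_val_zero, CharTwo.two_eq_zero, three_eq_one_zmod_two]
  rw [e]; decide

/-- **`BSD(E_{106}, 2)`** (`y² = x³ − 106²x`, class `179776i2`), journal door: Monsky (`hM`) + Burungale–Tian (`hBT`) + Deuring–Hecke (`hH`) + Burungale–Flach (`hBF`); membership `s(106) = 0` by `det_monskyMatrixEven_106`. [cite: BurungaleTian2026, Thm. 1.1] [cite: BurungaleFlach2024, Cor. 2] [cite: Miller2011LMS, Def. 1.1] -/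
theorem bsdp_two_congruentNumberCurve_106 (hM : monsky_card_selmerGroup_two_even)
    (hBT : burungaleTian_analyticRank_eq_zero_of_selmerCorank_eq_zero_of_hasCM)
    (hH : hasEntireLFunction_of_j_mem_maximalCMJInvariants)
    (hBF : bsdTriple_of_hasCM_of_L_one_ne_zero) : BSDp (congruentNumberCurve 106) 2 :=
  bsdp_two_congruentNumberCurve_of_det_even ![53] hM hBT hH hBF
    (by intro i; fin_cases i; norm_num) (by intro i; fin_cases i; decide) (by decide)
    det_monskyMatrixEven_106 (by simp)

/-- `n = 114` = 2 · 3 · 19: `n ≡ 2 (mod 8)`, Cremona class of `E_{114}` = `207936n2` (`N = 207936`); Monsky's matrix (even case, `k = 2`) has rows `1110;0001;1010;0110` and `det M = 1`, i.e. `s(114) = 0`. [cite: HeathBrown1994SelmerCongruentII, Appendix (Monsky), typescript p. 41 L20–L36] -/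
theorem det_monskyMatrixEven_114 : (monskyMatrixEven ![3, 19]).det = 1 := by
  have e : monskyMatrixEven ![3, 19] =
      Matrix.fromBlocks !![1, 1; 0, 0] !![1, 0; 0, 1] !![1, 0; 0, 1] !![1, 0; 1, 0] := by
    ext i j
    fin_cases i <;> fin_cases j <;>
      norm_num [monskyMatrixEven, legendreMatrix, legendreDiagonal, addLegendreSym,
        Matrix.fromBlocks, Finset.sum_erase_eq_sub, Fin.sum_univ_succ, Matrix.cons_val_succ,
        Matrix.cons_val_zero, CharTwo.two_eq_zero, three_eq_one_zmod_two] <;> decide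
  rw [e]; decide

/-- **`BSD(E_{114}, 2)`** (`y² = x³ − 114²x`, class `207936n2`), journal door: Monsky (`hM`) + Burungale–Tian (`hBT`) + Deuring–Hecke (`hH`) + Burungale–Flach (`hBF`); membership `s(114) = 0` by `det_monskyMatrixEven_114`. [cite: BurungaleTian2026, Thm. 1.1] [cite: BurungaleFlach2024, Cor. 2] [cite: Miller2011LMS, Def. 1.1] -/
theorem bsdp_two_congruentNumberCurve_114 (hM : monsky_card_selmerGroup_two_even)
    (hBT : burungaleTian_analyticRank_eq_zero_of_selmerCorank_eq_zero_of_hasCM)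
    (hH : hasEntireLFunction_of_j_mem_maximalCMJInvariants)
    (hBF : bsdTriple_of_hasCM_of_L_one_ne_zero) : BSDp (congruentNumberCurve 114) 2 :=
  bsdp_two_congruentNumberCurve_of_det_even ![3, 19] hM hBT hH hBF
    (by intro i; fin_cases i <;> norm_num) (by intro i; fin_cases i <;> decide) (by decide)
    det_monskyMatrixEven_114 (by simp [Fin.prod_univ_succ])

/-- `n = 122` = 2 · 61: `n ≡ 2 (mod 8)`, Cremona class of `E_{122}` = `238144o2` (`N = 238144`); Monsky's matrix (even case, `k = 1`) has rows `10;11` and `det M = 1`, i.e. `s(122) = 0`. [cite: HeathBrown1994SelmerCongruentII, Appendix (Monsky), typescript p. 41 L20–L36] -/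
theorem det_monskyMatrixEven_122 : (monskyMatrixEven ![61]).det = 1 := by
  have e : monskyMatrixEven ![61] =
      Matrix.fromBlocks !![1] !![0] !![1] !![1] := by
    ext i j
    fin_cases i <;> fin_cases j <;>
      norm_num [monskyMatrixEven, legendreMatrix, legendreDiagonal, addLegendreSym,
        Matrix.fromBlocks, Finset.sum_erase_eq_sub, Fin.sum_univ_succ, Matrix.cons_val_succ,
        Matrix.cons_val_zero, CharTwo.two_eq_zero, three_eq_one_zmod_two]
  rw [e]; decide

/-- **`BSD(E_{122}, 2)`** (`y² = x³ − 122²x`, class `238144o2`), journal door: Monsky (`hM`) + Burungale–Tian (`hBT`) + Deuring–Hecke (`hH`) + Burungale–Flach (`hBF`); membership `s(122) = 0` by `det_monskyMatrixEven_122`. [cite: BurungaleTian2026, Thm. 1.1] [cite: BurungaleFlach2024, Cor. 2] [cite: Miller2011LMS, Def. 1.1] -/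
theorem bsdp_two_congruentNumberCurve_122 (hM : monsky_card_selmerGroup_two_even)
    (hBT : burungaleTian_analyticRank_eq_zero_of_selmerCorank_eq_zero_of_hasCM)
    (hH : hasEntireLFunction_of_j_mem_maximalCMJInvariants)
    (hBF : bsdTriple_of_hasCM_of_L_one_ne_zero) : BSDp (congruentNumberCurve 122) 2 :=
  bsdp_two_congruentNumberCurve_of_det_even ![61] hM hBT hH hBF
    (by intro i; fin_cases i; norm_num) (by intro i; fin_cases i; decide) (by decide)
    det_monskyMatrixEven_122 (by simp)

/-- `n = 130` = 2 · 5 · 13: `n ≡ 2 (mod 8)`, Cremona class of `E_{130}` = `270400fh2` (`N = 270400`); Monsky's matrix (even case, `k = 2`) has rows `0100;1000;1001;0110` and `det M = 1`, i.e. `s(130) = 0`. [cite: HeathBrown1994SelmerCongruentII, Appendix (Monsky), typescript p. 41 L20–L36] -/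
theorem det_monskyMatrixEven_130 : (monskyMatrixEven ![5, 13]).det = 1 := by
  have e : monskyMatrixEven ![5, 13] =
      Matrix.fromBlocks !![0, 1; 1, 0] !![0, 0; 0, 0] !![1, 0; 0, 1] !![0, 1; 1, 0] := by
    ext i j
    fin_cases i <;> fin_cases j <;>
      norm_num [monskyMatrixEven, legendreMatrix, legendreDiagonal, addLegendreSym,
        Matrix.fromBlocks, Finset.sum_erase_eq_sub, Fin.sum_univ_succ, Matrix.cons_val_succ,
        Matrix.cons_val_zero, CharTwo.two_eq_zero, three_eq_one_zmod_two] <;> decide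
  rw [e]; decide

/-- **`BSD(E_{130}, 2)`** (`y² = x³ − 130²x`, class `270400fh2`), journal door: Monsky (`hM`) + Burungale–Tian (`hBT`) + Deuring–Hecke (`hH`) + Burungale–Flach (`hBF`); membership `s(130) = 0` by `det_monskyMatrixEven_130`. [cite: BurungaleTian2026, Thm. 1.1] [cite: BurungaleFlach2024, Cor. 2] [cite: Miller2011LMS, Def. 1.1] -/
theorem bsdp_two_congruentNumberCurve_130 (hM : monsky_card_selmerGroup_two_even)
    (hBT : burungaleTian_analyticRank_eq_zero_of_selmerCorank_eq_zero_of_hasCM)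
    (hH : hasEntireLFunction_of_j_mem_maximalCMJInvariants)
    (hBF : bsdTriple_of_hasCM_of_L_one_ne_zero) : BSDp (congruentNumberCurve 130) 2 :=
  bsdp_two_congruentNumberCurve_of_det_even ![5, 13] hM hBT hH hBF
    (by intro i; fin_cases i <;> norm_num) (by intro i; fin_cases i <;> decide) (by decide)
    det_monskyMatrixEven_130 (by simp [Fin.prod_univ_succ])

/-- `n = 170` = 2 · 5 · 17: `n ≡ 2 (mod 8)`, Cremona class of `E_{170}` = `462400ey2` (`N = 462400`); Monsky's matrix (even case, `k = 2`) has rows `0100;1100;1001;0011` and `det M = 1`, i.e. `s(170) = 0`. [cite: HeathBrown1994SelmerCongruentII, Appendix (Monsky), typescript p. 41 L20–L36] -/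
theorem det_monskyMatrixEven_170 : (monskyMatrixEven ![5, 17]).det = 1 := by
  have e : monskyMatrixEven ![5, 17] =
      Matrix.fromBlocks !![0, 1; 1, 1] !![0, 0; 0, 0] !![1, 0; 0, 0] !![0, 1; 1, 1] := by
    ext i j
    fin_cases i <;> fin_cases j <;>
      norm_num [monskyMatrixEven, legendreMatrix, legendreDiagonal, addLegendreSym,
        Matrix.fromBlocks, Finset.sum_erase_eq_sub, Fin.sum_univ_succ, Matrix.cons_val_succ,
        Matrix.cons_val_zero, CharTwo.two_eq_zero, three_eq_one_zmod_two] <;> decide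
  rw [e]; decide

/-- **`BSD(E_{170}, 2)`** (`y² = x³ − 170²x`, class `462400ey2`), journal door: Monsky (`hM`) + Burungale–Tian (`hBT`) + Deuring–Hecke (`hH`) + Burungale–Flach (`hBF`); membership `s(170) = 0` by `det_monskyMatrixEven_170`. [cite: BurungaleTian2026, Thm. 1.1] [cite: BurungaleFlach2024, Cor. 2] [cite: Miller2011LMS, Def. 1.1] -/
theorem bsdp_two_congruentNumberCurve_170 (hM : monsky_card_selmerGroup_two_even)
    (hBT : burungaleTian_analyticRank_eq_zero_of_selmerCorank_eq_zero_of_hasCM)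
    (hH : hasEntireLFunction_of_j_mem_maximalCMJInvariants)
    (hBF : bsdTriple_of_hasCM_of_L_one_ne_zero) : BSDp (congruentNumberCurve 170) 2 :=
  bsdp_two_congruentNumberCurve_of_det_even ![5, 17] hM hBT hH hBF
    (by intro i; fin_cases i <;> norm_num) (by intro i; fin_cases i <;> decide) (by decide)
    det_monskyMatrixEven_170 (by simp [Fin.prod_univ_succ])

/-- **ROLL-UP (even `n`)**: `BSD(E_n, 2)` for every even `n ∈ U_CN` with `s(n) = 0` — the list `[2, 10, 26, 42, 58, 66, 74, 106, 114, 122, 130, 170]` (12 pairs), journal door. [cite: BurungaleTian2026, Thm. 1.1] [cite: BurungaleFlach2024, Cor. 2] [cite: Miller2011LMS, Def. 1.1] -/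
theorem bsdp_two_congruentNumberCurve_of_mem_evenList (hM : monsky_card_selmerGroup_two_even)
    (hT : burungaleTian_analyticRank_eq_zero_of_selmerCorank_eq_zero_of_hasCM)
    (hH : hasEntireLFunction_of_j_mem_maximalCMJInvariants)
    (hF : bsdTriple_of_hasCM_of_L_one_ne_zero) :
    ∀ n ∈ ([2, 10, 26, 42, 58, 66, 74, 106, 114, 122, 130, 170] : List ℕ), BSDp (congruentNumberCurve n) 2 := by
  intro n hn
  simp only [List.mem_cons, List.not_mem_nil, or_false] at hn
  rcases hn with rfl | rfl | rfl | rfl | rfl | rfl | rfl | rfl | rfl | rfl | rfl | rfl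
  exacts [bsdp_two_congruentNumberCurve_2 hM hT hH hF,
    bsdp_two_congruentNumberCurve_10 hM hT hH hF, bsdp_two_congruentNumberCurve_26 hM hT hH hF,
    bsdp_two_congruentNumberCurve_42 hM hT hH hF, bsdp_two_congruentNumberCurve_58 hM hT hH hF,
    bsdp_two_congruentNumberCurve_66 hM hT hH hF, bsdp_two_congruentNumberCurve_74 hM hT hH hF,
    bsdp_two_congruentNumberCurve_106 hM hT hH hF, bsdp_two_congruentNumberCurve_114 hM hT hH hF,
    bsdp_two_congruentNumberCurve_122 hM hT hH hF, bsdp_two_congruentNumberCurve_130 hM hT hH hF,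
    bsdp_two_congruentNumberCurve_170 hM hT hH hF]

end Summit.BirchSwinnertonDyer.Rank1Residual.P2

end
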